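import Summits.BirchSwinnertonDyer.BirchSwinnertonDyer.Theorems.EisensteinDepletionAtTwoStarOggSaitoAtThree
import Literature.NumberTheory.EllipticCurves.PrimeConductorTwoTorsionProofs
import HarnessLib

/-!
# Line `star` (crux E1M, stmt-BirchSwinnertonDyer-20341): `stub_starAdmissibleHabitat` UNCONDITIONALLY

The cite-level stub `stub_starAdmissibleHabitat : StarAdmissibleHabitat` of the skeleton
`Cruxes/DepletedLambdaLawAtTwoMod/Lines/star.lean` (v3.6–v3.8, lead bsd-rank2-star-p1) — «every habitat curve (globally minimal,
good ordinary at `2`, a unique rational `2`-torsion point of Greenberg type A or B) has an admissible stabilisation datum at its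
conductor» — had THREE print inputs: Setzer 1975 (prime conductor + rational `2`-torsion ⇒ Neumann–Setzer or `N = 17`),
Cremona's Table 1 at conductor `17`, and Ogg–Saito at `3` (`ord₃ N ≤ 2` for a curve with a rational `2`-torsion point).
All three are now TREE THEOREMS:

* Setzer: `Literature.NumberTheory.EllipticCurves.Setzer1975_primeConductor_rationalTwoTorsion_holds` (lit GEN 23, p578097);
* conductor `17` with a rational `2`-torsion point: `Literature.NumberTheory.EllipticCurves.exists_smul_eq_of_conductorNorm_eq_seventeen`
  (lit GEN 23, p578097 — the `2`-torsion-restricted list, exactly the hypothesis of eng-2 g9's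
  `starNoPrimeHabitat_of_setzer_of_twoTorsionList`);
* Ogg–Saito at `3`: `oggSaitoAtThree` (eng-2 g10, p579867, over the Tate-algorithm walk p578717/p579251).

Hence this file proves, with NO hypothesis: `starNoPrimeHabitat` (the body of the v3.3 stub `StarNoPrimeHabitat`, verbatim),
`starAdmissibleHabitat` (the body of `StarAdmissibleHabitat`, verbatim — the lead closes the registered stub as
`theorem stub_starAdmissibleHabitat : StarAdmissibleHabitat := starAdmissibleHabitat`), and the level pair
`not_prime_and_factorization_three_le_two_of_habitat` («`N_W` not prime ∧ `ord₃ N_W ≤ 2`», the honest level hypothesis of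
`stub_starSymbC` / `stub_starSymbGlobal`, now free).

B1 honesty: classification bookkeeping for curves with a rational `2`-torsion point; nothing reads `r_an`; (★-SymbC)/(★)/E1M and
BSD are NOT proved by this file.

References: B. Setzer, *Elliptic curves of prime conductor*, J. LMS 10 (1975) [Setzer1975]; J. Cremona, *Algorithms for Modular
Elliptic Curves* (1997) Table 1 [Cremona1997]; J. H. Silverman, ATAEC (1994) IV.9.4, IV.10.2 [Silverman1994];
G. Stevens, *Arithmetic on Modular Curves* (1982) §2.4–2.5 [Stevens1982].
-/

set_option linter.dupNamespace false
set_option autoImplicit false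

noncomputable section

open scoped Classical

open WeierstrassCurve IsDedekindDomain Literature.NumberTheory.EllipticCurves
  Literature.NumberTheory.EllipticCurves.Greenberg1999

namespace Summit.BirchSwinnertonDyer.BirchSwinnertonDyer.Theorems.DepletionAtTwo

/-- **(★-NoPrime) UNCONDITIONALLY** — the body of the v3.3 stub `StarNoPrimeHabitat` verbatim: no habitat curve has prime
conductor (Setzer 1975 + the conductor-`17` list, both tree theorems, through eng-2 g9's
`starNoPrimeHabitat_of_setzer_of_twoTorsionList`). [cite: Setzer1975, Theorem 2] [cite: Cremona1997, Table 1 (N = 17)] -/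
theorem starNoPrimeHabitat :
    ∀ (W : WeierstrassCurve ℚ) [W.IsElliptic] [W.IsGloballyMinimal] (x : ℚ), IsOrdinaryAt W 2 →
      HasUniqueRationalTwoTorsionX W x →
      ((TwoTorsionRamifiedAtTwo x ∧ ¬ TwoTorsionOdd W x) ∨ (TwoTorsionOdd W x ∧ ¬ TwoTorsionRamifiedAtTwo x)) →
      ¬ (W.conductorNorm ℤ).Prime :=
  starNoPrimeHabitat_of_setzer_of_twoTorsionList Setzer1975_primeConductor_rationalTwoTorsion_holds
    exists_smul_eq_of_conductorNorm_eq_seventeen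

/-- **The honest level hypothesis of a habitat curve, UNCONDITIONALLY:** `N_W` is not prime and `ord₃ N_W ≤ 2`.
[cite: Setzer1975, Theorem 2] [cite: Silverman1994, IV.10.2] -/
theorem not_prime_and_factorization_three_le_two_of_habitat
    (W : WeierstrassCurve ℚ) [W.IsElliptic] [W.IsGloballyMinimal] (x : ℚ) (hord : IsOrdinaryAt W 2)
    (hx : HasUniqueRationalTwoTorsionX W x)
    (hAB : (TwoTorsionRamifiedAtTwo x ∧ ¬ TwoTorsionOdd W x) ∨ (TwoTorsionOdd W x ∧ ¬ TwoTorsionRamifiedAtTwo x)) :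
    ¬ (W.conductorNorm ℤ).Prime ∧ (W.conductorNorm ℤ).factorization 3 ≤ 2 :=
  ⟨starNoPrimeHabitat W x hord hx hAB, oggSaitoAtThree W x hx.1⟩

/-- **(★-AdmissibleHabitat) UNCONDITIONALLY** — the body of the registered stub `StarAdmissibleHabitat` of `Lines/star.lean`
(v3.6–v3.8) verbatim, with NO hypothesis: every habitat curve has an admissible stabilisation datum at `N_W`
(`exists_isAdmissibleStabData_conductorNorm_iff_of_isOrdinaryAt` ⟸ `N_W` not prime ∧ `ord₃ N_W ≤ 2`). The lead closes the stub as
`theorem stub_starAdmissibleHabitat : StarAdmissibleHabitat := starAdmissibleHabitat`.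
[cite: Setzer1975, Theorem 2] [cite: Cremona1997, Table 1 (N = 17)] [cite: Silverman1994, IV.10.2]
[cite: Stevens1982, §2.4–2.5 (PDF pp. 35–38) (admissibility)] -/
theorem starAdmissibleHabitat :
    ∀ (W : WeierstrassCurve ℚ) [W.IsElliptic] [W.IsGloballyMinimal] (x : ℚ), IsOrdinaryAt W 2 →
      HasUniqueRationalTwoTorsionX W x →
      ((TwoTorsionRamifiedAtTwo x ∧ ¬ TwoTorsionOdd W x) ∨ (TwoTorsionOdd W x ∧ ¬ TwoTorsionRamifiedAtTwo x)) →
      ∃ β : ℕ → ℕ, IsAdmissibleStabData (W.conductorNorm ℤ) β := by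
  intro W _ _ x hord hx hAB
  exact (exists_isAdmissibleStabData_conductorNorm_iff_of_isOrdinaryAt W hord).mpr
    (not_prime_and_factorization_three_le_two_of_habitat W x hord hx hAB)

end Summit.BirchSwinnertonDyer.BirchSwinnertonDyer.Theorems.DepletionAtTwo

end
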